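import Summits.AtomisticToContinuum.Crystallization.Theorems.FrustratedLawDichotomyStrainedPatchHomEntryFitHcpRotReal
import Summits.AtomisticToContinuum.Crystallization.Theorems.FrustratedLawDichotomyStrainedPatchHomEntryFitHcpMinPairsLeaf
import Summits.AtomisticToContinuum.Crystallization.Theorems.FrustratedLawDichotomyStrainedPatchHomOrthogonal

/-!
# The ROTATION-PAYLOAD fit verdict `fitOKHDMR` (kit + soundness): pair fit against a rational Cayley rotation of the hcp pattern, minimising scales only
# (27623 `(H) HomFloor (1/625)`, hcp half; hand-1 g31 FINDING §5; real theorem `…HomEntryFitHcpRotReal.goodAtScale_of_fitBounds_hcp_eta_minR`)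

decomp-a2c hand-1 g31 (crux `AperiodicFrustratedLawGap`, stmt-AtomisticToContinuum-27623).  The payload is an integer quaternion `q = (a, b, c, n)`; the rotation
is the exactly orthogonal rational matrix `cayQ q = cayM q / cayN q` (`cayN = n²+a²+b²+c²`), made a linear isometry by
`…HomOrthogonal.exists_linearIsometry_of_orthogonal`.  The pair misfit is evaluated NAIVELY on the box (no centred form): residual component
`λ·(n_k)_a + (R_k)_a − (δ_{k′}+λ−λ)… = λ n_k + R_k − ‖N_{k′}‖ · (Q n_k)` from the existing `…SharpKit` enclosures `rVec`, `dlt`, `nbrFI`, and the rotated pattern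
`qnFI q k a = Σ_j (cayM_aj / cayN) (n_k)_j`; test `10¹⁰·‖res‖².hi ≤ 24990001·d2S` (`η′ = 4999/10⁵`), only for scales `k′` passing `possMinH`.

* §1 `cayN`, `cayM`, `cayQ`, ★ `cayQ_orthogonal : 0 < cayN q → (cayQ q)ᵀ * cayQ q = 1` (polynomial identity);
* §2 `qnFI`, `resRFI`, `misRFI`, `rPairOK`, ★ `fitOKHDMR c w q` (= `fitOKHDM` with the pair test `rPairOK`);
* §3 ★★★ `fitOKHDMR_sound` (Tight shape; proof = `fitOKHDM_sound` verbatim except that the isometry `R` of `cayQ q` is threaded into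
  `goodAtScale_of_fitBounds_hcp_eta_minR` and bullet (F1) derives the rotated pair bound from the naive enclosure); `entryLeafOKHQDMR μ q` + `_sound` (hver shape).
Expected kernel gain at the in-slab extreme (float): `≈ −0.0016` misfit (rotation) minus the naive enclosure's extra excess (`≈ (9 − 3.9)·h_U`): net positive at
`2⁻¹³`; the centred form of `…CentredKit` with a rotated pattern is the sequel.

Computable definitions + soundness; 0 sorry; standard axioms; no instances / notation / `#eval`.  `--supports stmt-AtomisticToContinuum-27623`.
-/


noncomputable section

namespace Summit.AtomisticToContinuum.Crystallization.Theorems.FrustratedLawDichotomyStrainedPatchHomEntryFitHcpCentred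

open scoped BigOperators RealInnerProductSpace Matrix
open Summit.AtomisticToContinuum.Crystallization.Theorems.FrustratedLawDichotomyStrainedPatchHomOrthogonal (exists_linearIsometry_of_orthogonal)
open Literature.Analysis.ValidatedNumerics.Numerics
open Literature.Geometry.DiscreteGeometry (hcpKissingPattern)
open Literature.Geometry.DiscreteGeometry.ShellCensus (hcpTuple hcpTuple_injective)
open Summit.AtomisticToContinuum.Crystallization.Theorems.ChargedEnergyGapNegative (E3)
open Summit.AtomisticToContinuum.Crystallization.Theorems.FrustratedLawDichotomySchurCut (effPot w₄₅ ω₄)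
open Summit.AtomisticToContinuum.Crystallization.Theorems.FrustratedLawDichotomyMotifLemmas (GoodAtScale)
open Summit.AtomisticToContinuum.Crystallization.Theorems.FrustratedLawDichotomyAveragingRuleTightFree (TightNearCap BadNearCap)
open Summit.AtomisticToContinuum.Crystallization.Theorems.FrustratedLawDichotomyExemptAbsorption (ExemptNear)
open Summit.AtomisticToContinuum.Crystallization.Theorems.FrustratedLawDichotomyStrainedPatchHomSplit
open Summit.AtomisticToContinuum.Crystallization.Theorems.FrustratedLawDichotomyStrainedPatchHomGram (norm_sq_latPt_eq_sum_gram norm_sq_latPt_add_eq_sum_gram)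
open Summit.AtomisticToContinuum.Crystallization.Theorems.FrustratedLawDichotomyStrainedPatchHomLatticeBox (norm_apply_ge_of_near_one latPt_zero)
open Summit.AtomisticToContinuum.Crystallization.Theorems.FrustratedLawDichotomyStrainedPatchHomLatticeBoxHcp
  (latPt_eq_apply_one shifted_eq_apply mem_box_of_norm_hexPt_lt mem_box_of_norm_hexPt_add_shift_lt)
open Summit.AtomisticToContinuum.Crystallization.Theorems.FrustratedLawDichotomyStrainedPatchHomPrunesFit (goodAtScale_centre_of_fit_hcpPattern)
open Summit.AtomisticToContinuum.Crystallization.Theorems.FrustratedLawDichotomyAveragingCut (self_mem_ball)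
open Summit.AtomisticToContinuum.Crystallization.Theorems.FrustratedLawDichotomyStrainedPatchHomPrunes (locHom_hcp_centre)
open Summit.AtomisticToContinuum.Crystallization.Theorems.FrustratedLawDichotomyStrainedPatchHomPrunedPolar (homFloor_of_prunedBoxSums_selfAdjoint)
open Summit.AtomisticToContinuum.Crystallization.Theorems.FrustratedLawDichotomyStrainedPatchHomLeafCheckC (iccC iccC_eq)
open Summit.AtomisticToContinuum.Crystallization.Theorems.FrustratedLawDichotomyStrainedPatchHomCertTree (CertTree treeOK)
open Summit.AtomisticToContinuum.Crystallization.Theorems.FrustratedLawDichotomyStrainedPatchHomEntryGram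
open Summit.AtomisticToContinuum.Crystallization.Theorems.FrustratedLawDichotomyStrainedPatchHomEntryFitKit (lmin lmin_le_of_mem lmin_mem)
open Summit.AtomisticToContinuum.Crystallization.Theorems.FrustratedLawDichotomyStrainedPatchHomEntryFit (scaleL devFI entryLeafOKF fccHalf_of_entryFitTree lmax le_lmax_of_mem)
open Summit.AtomisticToContinuum.Crystallization.Theorems.FrustratedLawDichotomyStrainedPatchHomEntryGramHcp
open Summit.AtomisticToContinuum.Crystallization.Theorems.FrustratedLawDichotomyStrainedPatchHomEntryHcpFrame
open Summit.AtomisticToContinuum.Crystallization.Theorems.FrustratedLawDichotomyTwoShellRigidityAssemblyDial (hcpTuple_mem exists_hcpTuple_eq)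
open Summit.AtomisticToContinuum.Crystallization.Theorems.FrustratedLawDichotomyStrainedPatchHomLatticeBoxHcp (latPt_eq_apply_one)
open Summit.AtomisticToContinuum.Crystallization.Theorems.FrustratedLawDichotomyStrainedPatchHomEntryFit (scaleL devFI lmax le_lmax_of_mem)
open Summit.AtomisticToContinuum.Crystallization.Theorems.FrustratedLawDichotomyStrainedPatchHomEntryFitHcpKit
open Summit.AtomisticToContinuum.Crystallization.Theorems.FrustratedLawDichotomyStrainedPatchHomEntryFitHcp
open Summit.AtomisticToContinuum.Crystallization.Theorems.FrustratedLawDichotomyStrainedPatchHomEntrySearch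
open Summit.AtomisticToContinuum.Crystallization.Theorems.FrustratedLawDichotomyStrainedPatchHomEntrySign (entryLeafOKD fccHalf_of_entrySearchDom)
open Summit.AtomisticToContinuum.Crystallization.Theorems.FrustratedLawDichotomyStrainedPatchHomEntryFitHcpSharpKit
open Summit.AtomisticToContinuum.Crystallization.Theorems.FrustratedLawDichotomyStrainedPatchHomEntryFitHcpSharp

open Summit.AtomisticToContinuum.Crystallization.Theorems.FrustratedLawDichotomyStrainedPatchHomEntryFitHcpSharpEta
open Summit.AtomisticToContinuum.Crystallization.Theorems.FrustratedLawDichotomyStrainedPatchHomPrunedPolar (homFloor_of_prunedBoxSums_selfAdjoint)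
open Summit.AtomisticToContinuum.Crystallization.Theorems.FrustratedLawDichotomyStrainedPatchHomEntryGram (rootC rootW)
open Summit.AtomisticToContinuum.Crystallization.Theorems.FrustratedLawDichotomyStrainedPatchHomEntryGramHcp (rootCH rootWH)
open Summit.AtomisticToContinuum.Crystallization.Theorems.FrustratedLawDichotomyStrainedPatchHomEntryTable (muRec muRec_ok)
open Summit.AtomisticToContinuum.Crystallization.Theorems.FrustratedLawDichotomyStrainedPatchHomEntryTableP (entryLeafOK6RBKP)
open Summit.AtomisticToContinuum.Crystallization.Theorems.FrustratedLawDichotomyStrainedPatchHomEntryTreeCert (fccHalf_of_entryTree6RBKP)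
open Summit.AtomisticToContinuum.Crystallization.Theorems.FrustratedLawDichotomyStrainedPatchHomEntryFlipHcp (HcpDich hcpHalf_of_entryTreeShuf)
open Summit.AtomisticToContinuum.Crystallization.Theorems.FrustratedLawDichotomyStrainedPatchHomEntrySymBox (symH hbox_symU)
open Summit.AtomisticToContinuum.Crystallization.Theorems.FrustratedLawDichotomyStrainedPatchHomEntryQuickHcp (entryLeafOKHQ entryLeafOKHQ_imp)
open Summit.AtomisticToContinuum.Crystallization.Theorems.FrustratedLawDichotomyStrainedPatchHomLeafTableCheckHcpV (entryLeafOKHVK_sound)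
open Summit.AtomisticToContinuum.Crystallization.Theorems.FrustratedLawDichotomyStrainedPatchHomCurvLeafHCC (entryLeafOKHCCX entryLeafOKHCCX_sound)
open Summit.AtomisticToContinuum.Crystallization.Theorems.FrustratedLawDichotomyStrainedPatchHomEntryLeafHT
  (HTCert entryLeafOKHT4 entryLeafOKHT4_sound)
open Summit.AtomisticToContinuum.Crystallization.Theorems.FrustratedLawDichotomyStrainedPatchHomEntryFitTolerance (cT090 cT095 wU12X12 wU11X11)

/-! ## §1. The rational Cayley (quaternion) rotation -/

/-- Denominator `N = n² + a² + b² + c²` of the quaternion `q = (a, b, c, n)` (`q 0 = a`, …, `q 3 = n`). -/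
def cayN (q : Fin 4 → ℤ) : ℤ := q 3 ^ 2 + q 0 ^ 2 + q 1 ^ 2 + q 2 ^ 2

/-- Numerator matrix of the rotation of the quaternion `(n; a, b, c)` (times `N`). -/
def cayM (q : Fin 4 → ℤ) (i j : Fin 3) : ℤ :=
  (![![q 3 ^ 2 + q 0 ^ 2 - q 1 ^ 2 - q 2 ^ 2, 2 * (q 0 * q 1 - q 2 * q 3), 2 * (q 0 * q 2 + q 1 * q 3)],
     ![2 * (q 0 * q 1 + q 2 * q 3), q 3 ^ 2 - q 0 ^ 2 + q 1 ^ 2 - q 2 ^ 2, 2 * (q 1 * q 2 - q 0 * q 3)],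
     ![2 * (q 0 * q 2 - q 1 * q 3), 2 * (q 1 * q 2 + q 0 * q 3), q 3 ^ 2 - q 0 ^ 2 - q 1 ^ 2 + q 2 ^ 2]] : Fin 3 → Fin 3 → ℤ) i j

/-- The rational rotation matrix `cayM / cayN` (real entries). -/
def cayQ (q : Fin 4 → ℤ) : Matrix (Fin 3) (Fin 3) ℝ := fun i j => (cayM q i j : ℝ) / (cayN q : ℝ)

/-- ★ The Cayley/quaternion matrix is exactly orthogonal. [folklore: `MᵀM = N²·1` is a polynomial identity] -/
theorem cayQ_orthogonal (q : Fin 4 → ℤ) (hN : 0 < cayN q) : (cayQ q)ᵀ * cayQ q = 1 := by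
  have hN' : (cayN q : ℝ) ≠ 0 := by exact_mod_cast hN.ne'
  have eN : (cayN q : ℝ) = (q 3 : ℝ) ^ 2 + (q 0 : ℝ) ^ 2 + (q 1 : ℝ) ^ 2 + (q 2 : ℝ) ^ 2 := by simp [cayN]
  ext i j
  simp only [Matrix.mul_apply, Matrix.transpose_apply, cayQ, Fin.sum_univ_three, Matrix.one_apply]
  rw [eN] at hN' ⊢
  fin_cases i <;> fin_cases j <;>
    · simp [cayM]
      field_simp
      ring

/-! ## §2. The rotated pattern, the naive rotated residual, the verdict -/

/-- Rotated pattern component `(Q n_k)_a = Σ_j (cayM_aj / cayN) (n_k)_j` in the kernel. -/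
def qnFI (q : Fin 4 → ℤ) (k : Fin 12) (a : Fin 3) : FI := dot3 (fun j => FI.ofFrac (cayM q a j) (cayN q).toNat) (nbrFI k)

/-- Naive residual component `λ (n_k)_a + (R_k)_a − (δ_{k′} + λ)·(Q n_k)_a` of the rotated pair fit. -/
def resRFI (E' : Fin 3 × Fin 3 → FI) (X : Fin 3 → FI) (Lm : FI) (q : Fin 4 → ℤ) (k k' : Fin 12) (a : Fin 3) : FI :=
  ((Lm.mul (nbrFI k a)).add (rVec E' X Lm k a)).sub (((dlt E' X Lm k').add Lm).mul (qnFI q k a))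

/-- Naive enclosure of the rotated pair misfit `‖N_k − ‖N_{k′}‖ · Q n_k‖²`. -/
def misRFI (E' : Fin 3 × Fin 3 → FI) (X : Fin 3 → FI) (Lm : FI) (q : Fin 4 → ℤ) (k k' : Fin 12) : FI :=
  dot3 (resRFI E' X Lm q k k') (resRFI E' X Lm q k k')

/-- The rotated pair test at `η′ = 4999/10⁵`: `10¹⁰ · misR.hi ≤ 24990001 · d2S`. -/
def rPairOK (c w : (Fin 3 × Fin 3) ⊕ Fin 3 → ℤ) (L : ℤ) (q : Fin 4 → ℤ) (k k' : Fin 12) : Bool :=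
  decide (10000000000 * (misRFI (devH c w L) (shufFI c w) (FI.ofScaled L) q k k').hi ≤ 24990001 * d2S c w L)

/-- ★ **THE ROTATION-PAYLOAD FIT VERDICT**: `fitOKHDM` with the pair test replaced by the naive rotated test `rPairOK` (plus `0 < cayN q`). -/
def fitOKHDMR (c w : (Fin 3 × Fin 3) ⊕ Fin 3 → ℤ) (q : Fin 4 → ℤ) : Bool :=
  let L := scaleL (fun ab => c (Sum.inl ab))
  let D := dEnclH c w
  decide (c (Sum.inl (1, 0)) = c (Sum.inl (0, 1)) ∧ c (Sum.inl (2, 0)) = c (Sum.inl (0, 2)) ∧ c (Sum.inl (2, 1)) = c (Sum.inl (1, 2))) &&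
  decide (0 ≤ L) && decide (0 < D.lo) && decide (D.lo ≤ D.hi) && decide (2 * D.hi ≤ 3 * (SC : ℤ)) &&
  decide ((SC : ℤ) ≤ 130 * D.lo) && decide (4 * (xiSq c w).hi ≤ (SC : ℤ)) &&
  decide (0 < cayN q) && K12H.all (fun k => K12H.all fun k' => !possMinH c w k' || rPairOK c w L q k k') &&
  K12H.all (fun k => decide ((nbrSq c w k).hi * SC * 10000 ≤ (130 * D.lo - SC) ^ 2)) &&
  decide (∀ b ∈ box7all,
    (b = 0 ∨ (∃ k : Fin 12, hshift k = false ∧ hlab k = b) ∨ (130 * D.hi + (SC : ℤ)) ^ 2 ≤ (qform13 (extU c w) b false).lo * SC * 10000) ∧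
    ((∃ k : Fin 12, hshift k = true ∧ hlab k = b) ∨ (130 * D.hi + (SC : ℤ)) ^ 2 ≤ (qform13 (extU c w) b true).lo * SC * 10000))


/-! ## §3. Soundness -/

/-- ★★★ **SOUNDNESS OF `fitOKHDMR`** (Tight shape of `fitOKHD_sound`): `fitOKHDM_sound` verbatim except that the linear isometry `R` of the exactly orthogonal
`cayQ q` (`…HomOrthogonal.exists_linearIsometry_of_orthogonal`) is passed to `…RotReal.goodAtScale_of_fitBounds_hcp_eta_minR`, and bullet (F1) derives
`‖N_k − ‖N_{k′}‖ • R n_k‖² ≤ η′² d2lo` from the naive enclosure `misRFI` (memberships of `λ n_k + R_k`, `δ_{k′} + λ`, `Q n_k`). [folklore chaining] -/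
theorem fitOKHDMR_sound {c w : (Fin 3 × Fin 3) ⊕ Fin 3 → ℤ} {q : Fin 4 → ℤ} (h : fitOKHDMR c w q = true) (U : E3 →L[ℝ] E3) (ξ : E3)
    (_hsa : ∀ v v' : E3, ⟪U v, v'⟫ = ⟪v, U v'⟫) (hU : ‖U - 1‖ ≤ 1 / 4)
    (hbox : ∀ ab : Fin 3 × Fin 3, |(U (EuclideanSpace.single ab.2 (1 : ℝ))) ab.1 - (c (Sum.inl ab) : ℝ) / SC| ≤ (w (Sum.inl ab) : ℝ) / SC)
    (hξb : ∀ i : Fin 3, |ξ i - (c (Sum.inr i) : ℝ) / SC| ≤ (w (Sum.inr i) : ℝ) / SC) :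
    ∀ (M : ℕ) (z : Fin M → E3) (c : Fin M), Function.Injective z →
      Set.range z = {x : E3 | dist x (z c) ≤ 133 / 10 ∧ ∃ a : Fin 3 → ℤ,
        x = z c + latPt U hexFrame a ∨ x = z c + latPt U hexFrame a + U (hcpShift + ξ)} →
      TightNearCap (9 / 5) (3 / 2) z c ∨ ExemptNear (9 / 5) ExRec z c ∨ BadNearCap (9 / 5) (3 / 2) z c := by
  simp only [fitOKHDMR, Bool.and_eq_true, decide_eq_true_eq, List.all_eq_true] at h
  obtain ⟨⟨⟨⟨⟨⟨⟨⟨⟨⟨hsymm, hL0⟩, h0⟩, h01⟩, h32⟩, h130⟩, hxi4⟩, hNq⟩, hpair⟩, hK⟩, hfar⟩ := h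
  obtain ⟨Riso, hRiso⟩ := exists_linearIsometry_of_orthogonal (cayQ q) (cayQ_orthogonal q hNq)
  have hS := SC_pos
  have hne := SC_ne
  set cU : Fin 3 × Fin 3 → ℤ := fun ab => c (Sum.inl ab) with hcU
  set lam : ℝ := (scaleL cU : ℝ) / SC with hlam
  have hlam0 : 0 ≤ lam := div_nonneg (by exact_mod_cast hL0) hS.le
  set V : E3 →L[ℝ] E3 := U - lam • (1 : E3 →L[ℝ] E3) with hVdef
  have hV : ∀ x : E3, U x = lam • x + V x := fun x => by
    have : V x = U x - lam • x := by simp [hVdef]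
    rw [this]; abel
  -- enclosures of the extended Gram data of `U`, of the deviation entries and of the shuffle
  have hE : ∀ ab : Fin 3 × Fin 3, FI.mem ((U (EuclideanSpace.single ab.2 (1 : ℝ))) ab.1) (entU c w ab) := fun ab => mem_entryFI (hbox ab)
  have hE' : ∀ ab : Fin 3 × Fin 3, FI.mem ((V (EuclideanSpace.single ab.2 (1 : ℝ))) ab.1) (devH c w (scaleL cU) ab) :=
    FrustratedLawDichotomyStrainedPatchHomEntryFit.mem_devFI U (scaleL cU) hbox
  have hX : ∀ i, FI.mem (ξ i) (shufFI c w i) := fun i => mem_shufFI (hξb i)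
  have hLm : FI.mem lam (FI.ofScaled (scaleL cU)) := FI.mem_ofScaled _
  obtain ⟨hUG, hUC, hUT⟩ : (∀ i j, FI.mem ⟪U (hexFrame i), U (hexFrame j)⟫ (extU c w (Sum.inl (i, j)))) ∧
      (∀ i, FI.mem ⟪U (hexFrame i), U (hcpShift + ξ)⟫ (extU c w (Sum.inr (Sum.inl i)))) ∧
      FI.mem (‖U (hcpShift + ξ)‖ ^ 2) (extU c w (Sum.inr (Sum.inr 0))) := mem_extFI U ξ hE hX
  -- per label: ‖nbrU k‖² (Gram form, for `d`) and the sharp data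
  have hnbr : ∀ k, FI.mem (‖nbrU U ξ k‖ ^ 2) (nbrSq c w k) := fun k => by
    have := mem_qform13 U (hcpShift + ξ) hUG hUC hUT (hlab k) (hshift k)
    unfold nbrU nbrSq; exact this
  set R : Fin 12 → E3 := fun k => rReal V ξ lam k with hRdef
  have hdk : ∀ k, nbrU U ξ k = lam • nbr k + R k := fun k => nbrU_eq_smul_add_rReal hV ξ k
  have hRm : ∀ k a, FI.mem ((R k) a) (rVec (devH c w (scaleL cU)) (shufFI c w) (FI.ofScaled (scaleL cU)) k a) := fun k a =>
    mem_rVec V ξ hE' hX hLm k a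
  have hP : ∀ k, FI.mem ⟪R k, nbr k⟫ (rP (devH c w (scaleL cU)) (shufFI c w) (FI.ofScaled (scaleL cU)) k) := fun k =>
    mem_dot3 (hRm k) (mem_nbrFI k)
  have hQ : ∀ k, FI.mem (‖R k‖ ^ 2) (rSq (devH c w (scaleL cU)) (shufFI c w) (FI.ofScaled (scaleL cU)) k) := fun k => by
    rw [← real_inner_self_eq_norm_sq]; exact mem_dot3 (hRm k) (hRm k)
  have hN : ∀ k, FI.mem (‖nbrU U ξ k‖ ^ 2) (nrm2 (devH c w (scaleL cU)) (shufFI c w) (FI.ofScaled (scaleL cU)) k) := fun k => by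
    have e : ‖nbrU U ξ k‖ ^ 2 = (lam ^ 2 + lam * ⟪R k, nbr k⟫ * ((2 : ℤ) : ℝ)) + ‖R k‖ ^ 2 := by
      rw [hdk, norm_add_sq_real, norm_smul, Real.norm_eq_abs, abs_of_nonneg hlam0, norm_nbr, mul_one, real_inner_smul_left,
        real_inner_comm]
      push_cast; ring
    rw [e]
    exact FI.mem_add (FI.mem_add (FI.mem_sqr hLm) (FI.mem_mulInt (FI.mem_mul hLm (hP k)) 2)) (hQ k)
  have hD : ∀ k, FI.mem (‖nbrU U ξ k‖ - lam) (dlt (devH c w (scaleL cU)) (shufFI c w) (FI.ofScaled (scaleL cU)) k) := fun k => by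
    have := FI.mem_sqrt (hN k)
    rw [Real.sqrt_sq (norm_nonneg _)] at this
    exact FI.mem_sub this hLm
  have hMis : ∀ k k', FI.mem (‖nbrU U ξ k - ‖nbrU U ξ k'‖ • nbr k‖ ^ 2)
      (mis (devH c w (scaleL cU)) (shufFI c w) (FI.ofScaled (scaleL cU)) k k') := fun k k' => by
    have hsplit : nbrU U ξ k - ‖nbrU U ξ k'‖ • nbr k = R k - (‖nbrU U ξ k'‖ - lam) • nbr k := by
      rw [hdk, sub_smul]; abel
    have e : ‖nbrU U ξ k - ‖nbrU U ξ k'‖ • nbr k‖ ^ 2 =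
        (‖R k‖ ^ 2 - (‖nbrU U ξ k'‖ - lam) * ⟪R k, nbr k⟫ * ((2 : ℤ) : ℝ)) + (‖nbrU U ξ k'‖ - lam) ^ 2 := by
      rw [hsplit, norm_sub_sq_real, norm_smul, Real.norm_eq_abs, norm_nbr, mul_one, sq_abs, real_inner_smul_right]
      push_cast; ring
    rw [e]
    exact FI.mem_add (FI.mem_sub (hQ k) (FI.mem_mulInt (FI.mem_mul (hD k') (hP k)) 2)) (FI.mem_sqr (hD k'))
  -- `‖ξ‖ ≤ 1/2`
  have hxi : FI.mem (‖ξ‖ ^ 2) (xiSq c w) := by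
    rw [EuclideanSpace.norm_sq_eq, Fin.sum_univ_three]
    simp only [Real.norm_eq_abs, sq_abs]
    exact FI.mem_add (FI.mem_add (FI.mem_sqr (hX 0)) (FI.mem_sqr (hX 1))) (FI.mem_sqr (hX 2))
  have hξ2 : ‖ξ‖ ≤ 1 / 2 := by
    have h1 := (FI.mem_def.1 hxi).2
    have h2 : (4 : ℝ) * (xiSq c w).hi ≤ SC := by exact_mod_cast hxi4
    have h3 : ‖ξ‖ ^ 2 * SC * 4 ≤ SC * 1 := by linarith
    have hsq : ‖ξ‖ ^ 2 ≤ (1 / 2) ^ 2 := by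
      have := le_of_mul_le_mul_right (by linarith : ‖ξ‖ ^ 2 * 4 * SC ≤ 1 * SC) hS
      linarith
    exact (abs_le_of_sq_le_sq' hsq (by norm_num)).2
  -- the minimum and its enclosures
  obtain ⟨k₀, -, hk₀⟩ := Finset.exists_min_image Finset.univ (fun k : Fin 12 => ‖nbrU U ξ k‖) Finset.univ_nonempty
  have hd_le : ∀ k, ‖nbrU U ξ k₀‖ ≤ ‖nbrU U ξ k‖ := fun k => hk₀ k (Finset.mem_univ k)
  have hd0 : 0 ≤ ‖nbrU U ξ k₀‖ := norm_nonneg _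
  have hDsq_lo : ∀ k, ((dSqH c w).lo : ℝ) ≤ ‖nbrU U ξ k‖ ^ 2 * SC := fun k => by
    have h1 : lmin (K12H.map fun k => (nbrSq c w k).lo) ≤ (nbrSq c w k).lo := lmin_le_of_mem _ _ (List.mem_map.2 ⟨k, mem_K12H k, rfl⟩)
    have h1' : ((lmin (K12H.map fun k => (nbrSq c w k).lo) : ℤ) : ℝ) ≤ (nbrSq c w k).lo := by exact_mod_cast h1
    exact h1'.trans (FI.mem_def.1 (hnbr k)).1
  have hmemDsq : FI.mem (‖nbrU U ξ k₀‖ ^ 2) (dSqH c w) := by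
    refine ⟨hDsq_lo k₀, ?_⟩
    have hl : (K12H.map fun k => (nbrSq c w k).hi) ≠ [] := by simp [K12H]
    obtain ⟨k', _, he⟩ := List.mem_map.1 (lmin_mem _ hl)
    have h2 := (FI.mem_def.1 (hnbr k')).2
    have hle := mul_le_mul_of_nonneg_right (pow_le_pow_left₀ hd0 (hd_le k') 2) hS.le
    show ‖nbrU U ξ k₀‖ ^ 2 * SC ≤ (((dSqH c w).hi : ℤ) : ℝ)
    rw [show (dSqH c w).hi = lmin (K12H.map fun k => (nbrSq c w k).hi) from rfl, ← he]
    linarith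
  have hmemD : FI.mem ‖nbrU U ξ k₀‖ (dEnclH c w) := by
    have := FI.mem_sqrt hmemDsq
    rwa [Real.sqrt_sq hd0] at this
  obtain ⟨hDlo, hDhi⟩ := FI.mem_def.1 hmemD
  have h0' : (0 : ℝ) < (dEnclH c w).lo := by exact_mod_cast h0
  -- the sharp `d²` lower end
  have hd2S : ∀ k, ((d2S c w (scaleL cU) : ℤ) : ℝ) ≤ ‖nbrU U ξ k‖ ^ 2 * SC := fun k => by
    have h1 : d2S c w (scaleL cU) ≤ (nrm2 (devH c w (scaleL cU)) (shufFI c w) (FI.ofScaled (scaleL cU)) k).lo :=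
      lmin_le_of_mem _ _ (List.mem_map.2 ⟨k, mem_K12H k, rfl⟩)
    have h1' : ((d2S c w (scaleL cU) : ℤ) : ℝ) ≤ (nrm2 (devH c w (scaleL cU)) (shufFI c w) (FI.ofScaled (scaleL cU)) k).lo := by
      exact_mod_cast h1
    exact h1'.trans (FI.mem_def.1 (hN k)).1
  refine fun M z j hz hrange => Or.inl ⟨j, self_mem_ball (by norm_num) z j,
    goodAtScale_of_fitBounds_hcp_eta_minR Riso U ξ hU hξ2 (η' := 4999 / 100000) (by norm_num) (by norm_num) (dlo := ((dEnclH c w).lo : ℝ) / SC) (dhi := ((dEnclH c w).hi : ℝ) / SC)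
      (d2lo := ((d2S c w (scaleL cU) : ℤ) : ℝ) / SC) (div_pos h0' hS) ?_ ?_ ?_ ?_ ?_ ?_ ?_ ?_ M z j hz (locHom_hcp_centre hrange)⟩
  · -- dhi ≤ 3/2
    rw [div_le_iff₀ hS]
    have : (2 : ℝ) * (dEnclH c w).hi ≤ 3 * SC := by exact_mod_cast h32
    linarith
  · -- (d) lower
    intro k
    have := mul_le_mul_of_nonneg_right (hd_le k) hS.le
    rw [div_le_iff₀ hS]
    linarith
  · -- (d) upper
    exact ⟨k₀, by rw [le_div_iff₀ hS]; exact hDhi⟩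
  · -- d2lo
    intro k
    rw [div_le_iff₀ hS]
    exact hd2S k
  · -- (F1) the NAIVE ROTATED pair bound, for minimising scales `k'` only
    intro k k' hk'
    have hposs : possMinH c w k' = true := by
      unfold possMinH
      rw [decide_eq_true_eq]
      have hl : (K12H.map fun k => (nbrSq c w k).hi) ≠ [] := by simp [K12H]
      obtain ⟨j', _, he⟩ := List.mem_map.1 (lmin_mem _ hl)
      have h1 := (FI.mem_def.1 (hnbr k')).1
      have h2 := (FI.mem_def.1 (hnbr j')).2
      have hle := mul_le_mul_of_nonneg_right (pow_le_pow_left₀ (norm_nonneg _) (hk' j') 2) hS.le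
      have key : (((nbrSq c w k').lo : ℤ) : ℝ) ≤ ((lmin (K12H.map fun k => (nbrSq c w k).hi) : ℤ) : ℝ) := by
        rw [← he]
        linarith
      have key' : (nbrSq c w k').lo ≤ lmin (K12H.map fun k => (nbrSq c w k).hi) := by exact_mod_cast key
      exact key'
    have hp := hpair k (mem_K12H k) k' (mem_K12H k')
    rw [hposs] at hp
    have hok : 10000000000 * (misRFI (devH c w (scaleL cU)) (shufFI c w) (FI.ofScaled (scaleL cU)) q k k').hi ≤ 24990001 * d2S c w (scaleL cU) := by
      simpa [rPairOK] using hp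
    -- the rotated pattern and the residual, componentwise
    have hNpos : 0 < (cayN q).toNat := by omega
    have hNcast : (((cayN q).toNat : ℕ) : ℝ) = (cayN q : ℝ) := by
      have : ((cayN q).toNat : ℤ) = cayN q := Int.toNat_of_nonneg hNq.le
      exact_mod_cast this
    have hQn : ∀ a, FI.mem ((Riso (nbr k)) a) (qnFI q k a) := fun a => by
      rw [hRiso (nbr k) a, Fin.sum_univ_three]
      have e : ∀ j, cayQ q a j = ((cayM q a j : ℤ) : ℝ) / (((cayN q).toNat : ℕ) : ℝ) := fun j => by rw [hNcast]; rfl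
      rw [e 0, e 1, e 2]
      exact FI.mem_add (FI.mem_add (FI.mem_mul (FI.mem_ofFrac _ hNpos) (mem_nbrFI k 0)) (FI.mem_mul (FI.mem_ofFrac _ hNpos) (mem_nbrFI k 1)))
        (FI.mem_mul (FI.mem_ofFrac _ hNpos) (mem_nbrFI k 2))
    have hres : ∀ a, FI.mem ((nbrU U ξ k - ‖nbrU U ξ k'‖ • Riso (nbr k)) a)
        (resRFI (devH c w (scaleL cU)) (shufFI c w) (FI.ofScaled (scaleL cU)) q k k' a) := fun a => by
      have e : (nbrU U ξ k - ‖nbrU U ξ k'‖ • Riso (nbr k)) a =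
          (lam * (nbr k) a + (R k) a) - ((‖nbrU U ξ k'‖ - lam) + lam) * (Riso (nbr k)) a := by
        rw [PiLp.sub_apply, PiLp.smul_apply, smul_eq_mul, hdk k, PiLp.add_apply, PiLp.smul_apply, smul_eq_mul]
        ring
      rw [e]
      exact FI.mem_sub (FI.mem_add (FI.mem_mul hLm (mem_nbrFI k a)) (hRm k a)) (FI.mem_mul (FI.mem_add (hD k') hLm) (hQn a))
    have hmis : FI.mem (‖nbrU U ξ k - ‖nbrU U ξ k'‖ • Riso (nbr k)‖ ^ 2)
        (misRFI (devH c w (scaleL cU)) (shufFI c w) (FI.ofScaled (scaleL cU)) q k k') := by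
      rw [← real_inner_self_eq_norm_sq]
      exact mem_dot3 hres hres
    have h1 := (FI.mem_def.1 hmis).2
    have hok' : (10000000000 : ℝ) * ((misRFI (devH c w (scaleL cU)) (shufFI c w) (FI.ofScaled (scaleL cU)) q k k').hi : ℝ) ≤
        24990001 * (d2S c w (scaleL cU) : ℝ) := by exact_mod_cast hok
    rw [show ((4999 : ℝ) / 100000) ^ 2 * (((d2S c w (scaleL cU) : ℤ) : ℝ) / SC) = (24990001 * ((d2S c w (scaleL cU) : ℤ) : ℝ)) / (10000000000 * SC) by
      field_simp; ring]
    rw [le_div_iff₀ (by positivity)]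
    nlinarith [norm_nonneg (nbrU U ξ k - ‖nbrU U ξ k'‖ • Riso (nbr k))]
  · -- (F2) clean gap
    intro k
    have f3 := hK k (mem_K12H k)
    have hC := (FI.mem_def.1 (hnbr k)).2
    have f3' : ((nbrSq c w k).hi : ℝ) * SC * 10000 ≤ (130 * (dEnclH c w).lo - SC) ^ 2 := by exact_mod_cast f3
    have h130' : (SC : ℝ) ≤ 130 * (dEnclH c w).lo := by exact_mod_cast h130
    have hC' := mul_le_mul_of_nonneg_right hC (by positivity : (0 : ℝ) ≤ SC * 10000)
    have hsq : (‖nbrU U ξ k‖ * (100 * SC)) ^ 2 ≤ ((130 : ℝ) * (dEnclH c w).lo - SC) ^ 2 := by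
      have e : (‖nbrU U ξ k‖ * (100 * SC)) ^ 2 = ‖nbrU U ξ k‖ ^ 2 * SC * (SC * 10000) := by ring
      rw [e]; linarith
    have hle := (abs_le_of_sq_le_sq' hsq (by linarith)).2
    rw [show (13 : ℝ) / 10 * (((dEnclH c w).lo : ℝ) / SC) - 1 / 100 = (130 * ((dEnclH c w).lo : ℝ) - SC) / (100 * SC) by field_simp; ring,
      le_div_iff₀ (by positivity)]
    exact hle
  · -- (F3) far, family A
    intro b hb hb0 hnot
    rw [← box7all_eq] at hb
    obtain ⟨hA, _⟩ := hfar b hb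
    rcases hA with rfl | ⟨k, hk, he⟩ | f4
    · exact (hb0 rfl).elim
    · exact (hnot k hk he).elim
    · have f4' : ((130 : ℝ) * (dEnclH c w).hi + SC) ^ 2 ≤ ((qform13 (extU c w) b false).lo : ℝ) * SC * 10000 := by exact_mod_cast f4
      have hm := mem_qform13 U (hcpShift + ξ) hUG hUC hUT b false
      simp only [Bool.false_eq_true, ↓reduceIte, add_zero] at hm
      have hC := (FI.mem_def.1 hm).1
      have hC' := mul_le_mul_of_nonneg_right hC (by positivity : (0 : ℝ) ≤ SC * 10000)
      have hsq : ((130 : ℝ) * (dEnclH c w).hi + SC) ^ 2 ≤ (‖latPt U hexFrame b‖ * (100 * SC)) ^ 2 := by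
        have e : (‖latPt U hexFrame b‖ * (100 * SC)) ^ 2 = ‖latPt U hexFrame b‖ ^ 2 * SC * (SC * 10000) := by ring
        rw [e]; linarith
      have hle := (abs_le_of_sq_le_sq' hsq (by positivity)).2
      rw [show (13 : ℝ) / 10 * (((dEnclH c w).hi : ℝ) / SC) + 1 / 100 = (130 * ((dEnclH c w).hi : ℝ) + SC) / (100 * SC) by field_simp; ring,
        div_le_iff₀ (by positivity)]
      exact hle
  · -- (F3) far, family B
    intro b hb hnot
    rw [← box7all_eq] at hb
    obtain ⟨_, hB⟩ := hfar b hb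
    rcases hB with ⟨k, hk, he⟩ | f4
    · exact (hnot k hk he).elim
    · have f4' : ((130 : ℝ) * (dEnclH c w).hi + SC) ^ 2 ≤ ((qform13 (extU c w) b true).lo : ℝ) * SC * 10000 := by exact_mod_cast f4
      have hm := mem_qform13 U (hcpShift + ξ) hUG hUC hUT b true
      simp only [↓reduceIte] at hm
      have hC := (FI.mem_def.1 hm).1
      have hC' := mul_le_mul_of_nonneg_right hC (by positivity : (0 : ℝ) ≤ SC * 10000)
      have hsq : ((130 : ℝ) * (dEnclH c w).hi + SC) ^ 2 ≤ (‖latPt U hexFrame b + U (hcpShift + ξ)‖ * (100 * SC)) ^ 2 := by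
        have e : (‖latPt U hexFrame b + U (hcpShift + ξ)‖ * (100 * SC)) ^ 2 = ‖latPt U hexFrame b + U (hcpShift + ξ)‖ ^ 2 * SC * (SC * 10000) := by
          ring
        rw [e]; linarith
      have hle := (abs_le_of_sq_le_sq' hsq (by positivity)).2
      rw [show (13 : ℝ) / 10 * (((dEnclH c w).hi : ℝ) / SC) + 1 / 100 = (130 * ((dEnclH c w).hi : ℝ) + SC) / (100 * SC) by field_simp; ring,
        div_le_iff₀ (by positivity)]
      exact hle

/-- ★ **hcp QUICK VERDICT WITH THE ROTATION PAYLOAD**: min-pairs centred fit `fitOKHDM`, else the naive rotated fit `fitOKHDMR … q`, else the quick verdict of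
record `entryLeafOKHQ μ` (union: the centred form is sharper at `2⁻¹²`, the rotated one at the sheared in-slab extremes). -/
def entryLeafOKHQDMR (μ : ℤ) (q : Fin 4 → ℤ) (c w : (Fin 3 × Fin 3) ⊕ Fin 3 → ℤ) : Bool :=
  fitOKHDM (symH c) (symH w) || fitOKHDMR (symH c) (symH w) q || entryLeafOKHQ μ c w

/-- ★ **Soundness of `entryLeafOKHQDMR` in the hver shape** (exactly the `hinner` hypothesis of `…HomEntryLeafHT4.entryLeafOKHT4_sound`). [folklore chaining:
`fitOKHDM_sound` on the symmetrised box (`hbox_symU`), else `entryLeafOKHQ_imp` + `entryLeafOKHVK_sound`] -/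
theorem entryLeafOKHQDMR_sound {μ : ℤ} {q : Fin 4 → ℤ} (c w : (Fin 3 × Fin 3) ⊕ Fin 3 → ℤ) (h : entryLeafOKHQDMR μ q c w = true) (U : E3 →L[ℝ] E3) (ξ : E3)
    (hsa : ∀ v v' : E3, ⟪U v, v'⟫ = ⟪v, U v'⟫) (hU : ‖U - 1‖ ≤ 1 / 4)
    (hbox : ∀ ab : Fin 3 × Fin 3, |(U (EuclideanSpace.single ab.2 (1 : ℝ))) ab.1 - (c (Sum.inl ab) : ℝ) / SC| ≤ (w (Sum.inl ab) : ℝ) / SC)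
    (hξ : ∀ i : Fin 3, |ξ i - (c (Sum.inr i) : ℝ) / SC| ≤ (w (Sum.inr i) : ℝ) / SC) (h0 : 0 ≤ ξ 0) (h2 : 0 ≤ ξ 2) :
    (∀ (M : ℕ) (z : Fin M → E3) (cc : Fin M), Function.Injective z →
        Set.range z = {x : E3 | dist x (z cc) ≤ 133 / 10 ∧ ∃ a : Fin 3 → ℤ,
          x = z cc + latPt U hexFrame a ∨ x = z cc + latPt U hexFrame a + U (hcpShift + ξ)} →
        TightNearCap (9 / 5) (3 / 2) z cc ∨ ExemptNear (9 / 5) ExRec z cc ∨ BadNearCap (9 / 5) (3 / 2) z cc) ∨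
      (μ : ℝ) / SC ≤ ∑ b ∈ (Fintype.piFinset fun _ : Fin 3 => Finset.Icc (-7 : ℤ) 7).filter (fun b => b ≠ 0), effPot w₄₅ ω₄ (3 / 400) ‖latPt U hexFrame b‖ +
        ∑ b ∈ (Fintype.piFinset fun _ : Fin 3 => Finset.Icc (-7 : ℤ) 7), effPot w₄₅ ω₄ (3 / 400) ‖latPt U hexFrame b + U (hcpShift + ξ)‖ := by
  simp only [entryLeafOKHQDMR, Bool.or_eq_true] at h
  rcases h with (h | h) | h
  · exact Or.inl (fitOKHDM_sound h U ξ hsa hU (hbox_symU hsa hbox) hξ)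
  · exact Or.inl (fitOKHDMR_sound h U ξ hsa hU (hbox_symU hsa hbox) hξ)
  · exact entryLeafOKHVK_sound (entryLeafOKHQ_imp μ c w h) U ξ hsa hU hbox hξ h0 h2



end Summit.AtomisticToContinuum.Crystallization.Theorems.FrustratedLawDichotomyStrainedPatchHomEntryFitHcpCentred

end
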